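import Summits.AtomisticToContinuum.HydrodynamicLimit.Theorems.DensityCap.Negative.KernelMass
import Summits.AtomisticToContinuum.HydrodynamicLimit.Theorems.DenseExcursion.Negative.Everywhere
import Summits.AtomisticToContinuum.HydrodynamicLimit.Theorems.PolynomialCompression.Negative.Ladder
import Literature.Analysis.FluidPDE.HardSphereTorusMeasure
import Literature.Analysis.FluidPDE.ConfinedHardSphereFlowShortBad
import Literature.Analysis.FluidPDE.HardSpherePhaseSpaceProofs
import Literature.MathematicalPhysics.KineticTheory.HardSphereCanonicalTorus
import Literature.Barriers.AtomisticToContinuum.DiluteRegime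

/-!
# Hard-core packing bound for the mollified empirical density of the crux `DensityCap`; equal mass; first moment

Negative-side structure for the crux `JParityClosure.DensityCap` (stmt-AtomisticToContinuum-13082), from the standing
disprover's `Cruxes/DensityCap/Disproof.lean` §8a–b (cycle 2). Three SURE facts (no hydrodynamics) behind the implosion
hazard of the UNGUARDED crux (`Negative/DensityCapFalseOfDenseExcursionAbovePacking.lean`):
* `card_filter_near_le` — HARD-CORE PACKING COUNT: centres pairwise at minimal-image distance `≥ ε` number at most
  `((2r+ε)/ε)³` in a minimal-image ball of radius `r` (disjoint `ε/2`-balls inside the `(r+ε/2)`-ball; Haar volumes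
  of minimal-image balls are Euclidean, `Torus.volume_euclidDist_lt`, and scale like `R³`, `addHaar_ball_of_pos`);
* `mollDensity_le_packing` / `mollDensity_le_packing_hs` — hence on the hard-sphere domain the `r`-mollified empirical
  density is SURELY `≤ 81/(π(N+1)ε_N³) = 81/(πσ³)` everywhere once `ε_N ≤ r ≤ 1/4` (`hsDiameter_pow_three`): the
  "no concentration" role is free for hard cores (ideator card 7 `PackingBound`, now a theorem);
* `integral_mollDensity_eq_one` — EQUAL MASS `∫ ρ̄ʳ(w) = 1` (`coneMass_eq_one`), and `exists_overshoot_of_dense` —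
  FIRST MOMENT: `f ≤ M` everywhere, `g ≥ M + κ` on `B`, `∫ g ≤ ∫ f`, `0 ≤ η < κ vol B` ⇒ `g x + η < f x` somewhere.
refuter-cdisprove-stmt-AtomisticToContinuum-13082-g2-0.
-/

noncomputable section

namespace Summit.AtomisticToContinuum.HydrodynamicLimit.Theorems.DensityCapNegative

open MeasureTheory Filter Set Topology Metric
open scoped ENNReal
open Literature.MathematicalPhysics.KineticTheory Literature.Analysis.FluidPDE
open Literature.Analysis.FunctionSpaces
open Summit.AtomisticToContinuum.HydrodynamicLimit.Theses.JParityClosure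
open Summit.AtomisticToContinuum.HydrodynamicLimit.Theorems.PolynomialCompressionPDE (Flows flows_nonempty)
open Summit.AtomisticToContinuum.HydrodynamicLimit.Theorems.PolynomialCompressionAt (Reaches)

/-! ## §1 Hard-core packing: counting centres in a minimal-image ball -/

/-- Minimal-image balls are measurable. -/
theorem measurableSet_euclidBall (c : T3) (R : ℝ) : MeasurableSet {y : T3 | Torus.euclidDist y c < R} := by
  have hm : Measurable fun y : T3 => Torus.euclidDist y c := by
    unfold Torus.euclidDist
    exact (Torus.measurable_reprSym.comp (measurable_id.sub measurable_const)).norm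
  exact hm measurableSet_Iio

/-- Haar volume of a minimal-image ball of radius `R < 1/2`: it is the Euclidean volume, which scales like `R³`. -/
theorem volume_euclidBall {R : ℝ} (hR : 0 < R) (hR2 : R < 1 / 2) (c : T3) :
    volume {y : T3 | Torus.euclidDist y c < R} =
      ENNReal.ofReal (R ^ 3) * volume (ball (0 : EuclideanSpace ℝ (Fin 3)) 1) := by
  rw [Torus.volume_euclidDist_lt hR2 c, Measure.addHaar_ball_of_pos _ _ hR, finrank_euclideanSpace_fin]

/-- **Hard-core packing count.** If the centres `c i` are pairwise at minimal-image distance `≥ ε > 0`, then at most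
`((r + ε/2)/(ε/2))³ = ((2r+ε)/ε)³` of them lie in a minimal-image ball of radius `r` (`r + ε/2 < 1/2`): the
`ε/2`-balls about those centres are pairwise disjoint and contained in the `(r + ε/2)`-ball. -/
theorem card_filter_near_le {n : ℕ} {ε r : ℝ} (hε : 0 < ε) (hr : 0 < r) (hr2 : r + ε / 2 < 1 / 2)
    (c : Fin n → T3) (hsep : ∀ i j, i ≠ j → ε ≤ Torus.euclidDist (c i) (c j)) (x₀ : T3) :
    ((Finset.univ.filter fun i => Torus.euclidDist (c i) x₀ < r).card : ℝ) ≤ ((r + ε / 2) / (ε / 2)) ^ 3 := by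
  set S : Finset (Fin n) := Finset.univ.filter fun i => Torus.euclidDist (c i) x₀ < r with hS
  set B : Fin n → Set T3 := fun i => {y | Torus.euclidDist y (c i) < ε / 2} with hB
  have hBm : ∀ i, MeasurableSet (B i) := fun i => measurableSet_euclidBall (c i) (ε / 2)
  have hdisj : Set.PairwiseDisjoint (↑S : Set (Fin n)) B := by
    intro i _ j _ hij
    show Disjoint (B i) (B j)
    rw [Set.disjoint_left]
    intro y hyi hyj
    have h1 := hsep i j hij
    have h2 := Torus.euclidDist_triangle (c i) y (c j)
    rw [Torus.euclidDist_comm (c i) y] at h2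
    have hyi' : Torus.euclidDist y (c i) < ε / 2 := hyi
    have hyj' : Torus.euclidDist y (c j) < ε / 2 := hyj
    linarith
  have hsub : (⋃ i ∈ S, B i) ⊆ {y : T3 | Torus.euclidDist y x₀ < r + ε / 2} := by
    intro y hy
    simp only [Set.mem_iUnion, exists_prop] at hy
    obtain ⟨i, hi, hyi⟩ := hy
    have hi' : Torus.euclidDist (c i) x₀ < r := (Finset.mem_filter.1 hi).2
    have h2 := Torus.euclidDist_triangle y (c i) x₀
    have hyi' : Torus.euclidDist y (c i) < ε / 2 := hyi
    show Torus.euclidDist y x₀ < r + ε / 2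
    linarith
  have hvolU : volume (⋃ i ∈ S, B i) = ∑ i ∈ S, volume (B i) :=
    measure_biUnion_finset hdisj fun i _ => hBm i
  have hε2 : 0 < ε / 2 := by linarith
  have hε22 : ε / 2 < 1 / 2 := by linarith
  have hR : 0 < r + ε / 2 := by linarith
  have hBvol : ∀ i, volume (B i) =
      ENNReal.ofReal ((ε / 2) ^ 3) * volume (ball (0 : EuclideanSpace ℝ (Fin 3)) 1) :=
    fun i => volume_euclidBall hε2 hε22 (c i)
  have hbig : volume {y : T3 | Torus.euclidDist y x₀ < r + ε / 2} =
      ENNReal.ofReal ((r + ε / 2) ^ 3) * volume (ball (0 : EuclideanSpace ℝ (Fin 3)) 1) :=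
    volume_euclidBall hR hr2 x₀
  have hv0 : volume (ball (0 : EuclideanSpace ℝ (Fin 3)) 1) ≠ 0 := (measure_ball_pos volume _ one_pos).ne'
  have hvT : volume (ball (0 : EuclideanSpace ℝ (Fin 3)) 1) ≠ ⊤ := measure_ball_lt_top.ne
  have key : (S.card : ℝ≥0∞) * ENNReal.ofReal ((ε / 2) ^ 3) * volume (ball (0 : EuclideanSpace ℝ (Fin 3)) 1) ≤
      ENNReal.ofReal ((r + ε / 2) ^ 3) * volume (ball (0 : EuclideanSpace ℝ (Fin 3)) 1) := by
    calc (S.card : ℝ≥0∞) * ENNReal.ofReal ((ε / 2) ^ 3) * volume (ball (0 : EuclideanSpace ℝ (Fin 3)) 1)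
        = ∑ i ∈ S, volume (B i) := by
          rw [Finset.sum_congr rfl fun i _ => hBvol i, Finset.sum_const, nsmul_eq_mul, mul_assoc]
      _ = volume (⋃ i ∈ S, B i) := hvolU.symm
      _ ≤ volume {y : T3 | Torus.euclidDist y x₀ < r + ε / 2} := measure_mono hsub
      _ = _ := hbig
  have key2 : (S.card : ℝ≥0∞) * ENNReal.ofReal ((ε / 2) ^ 3) ≤ ENNReal.ofReal ((r + ε / 2) ^ 3) :=
    (ENNReal.mul_le_mul_iff_left hv0 hvT).1 key
  have key3 : (S.card : ℝ) * (ε / 2) ^ 3 ≤ (r + ε / 2) ^ 3 := by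
    have h := ENNReal.toReal_mono ENNReal.ofReal_ne_top key2
    rw [ENNReal.toReal_mul, ENNReal.toReal_ofReal (by positivity), ENNReal.toReal_ofReal (by positivity)] at h
    simpa using h
  rw [div_pow, le_div_iff₀ (by positivity)]
  exact key3

/-- Off the ball of radius `r` the cone kernel vanishes. -/
theorem cone_eq_zero_of_le {r : ℝ} (hr : 0 < r) {x y : T3} (h : r ≤ Torus.euclidDist x y) : cone r x y = 0 := by
  unfold cone
  rw [max_eq_right, mul_zero]
  rw [sub_nonpos, le_div_iff₀ hr, one_mul]
  exact h

/-- The mollified density at `x₀` only sees the particles within distance `r` of `x₀`, each with weight `≤ 3/(πr³)`. -/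
theorem mollDensity_le_card_mul {r : ℝ} (hr : 0 < r) {n : ℕ} (w : Config n (Fin 3) T3) (x₀ : T3) :
    mollDensity r w x₀ ≤
      (n : ℝ)⁻¹ * ((Finset.univ.filter fun i => Torus.euclidDist (w i).1 x₀ < r).card * (3 / (Real.pi * r ^ 3))) := by
  rw [mollDensity_eq]
  gcongr
  have hc0 : 0 ≤ 3 / (Real.pi * r ^ 3) := div_nonneg (by norm_num) (by positivity)
  calc ∑ i, cone r (w i).1 x₀
      = ∑ i, (if Torus.euclidDist (w i).1 x₀ < r then cone r (w i).1 x₀ else 0) := by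
        refine Finset.sum_congr rfl fun i _ => ?_
        split_ifs with h
        · rfl
        · exact cone_eq_zero_of_le hr (not_lt.1 h)
    _ = ∑ i ∈ Finset.univ.filter (fun i => Torus.euclidDist (w i).1 x₀ < r), cone r (w i).1 x₀ := by
        rw [Finset.sum_filter]
    _ ≤ ∑ _i ∈ Finset.univ.filter (fun i => Torus.euclidDist (w i).1 x₀ < r), 3 / (Real.pi * r ^ 3) :=
        Finset.sum_le_sum fun i _ => cone_le hr _ _
    _ = _ := by rw [Finset.sum_const, nsmul_eq_mul]

/-- **Packing bound for separated configurations.** If the positions of `w` are pairwise at minimal-image distance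
`≥ ε`, `0 < ε ≤ r ≤ 1/4`, then the `r`-mollified empirical density is at most `81/(π n ε³)` EVERYWHERE
(`((2r+ε)/ε)³ ≤ 27 r³/ε³` centres, weight `3/(πr³)` each). -/
theorem mollDensity_le_packing {r ε : ℝ} (hε : 0 < ε) (hεr : ε ≤ r) (hr4 : r ≤ 1 / 4) {n : ℕ}
    (w : Config n (Fin 3) T3) (hsep : ∀ i j, i ≠ j → ε ≤ Torus.euclidDist (w i).1 (w j).1) (x₀ : T3) :
    mollDensity r w x₀ ≤ 81 / (Real.pi * n * ε ^ 3) := by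
  rcases Nat.eq_zero_or_pos n with hn | hn
  · subst hn
    have h0 : mollDensity r w x₀ = 0 := by rw [mollDensity_eq]; simp
    rw [h0]
    simp
  have hr : 0 < r := lt_of_lt_of_le hε hεr
  have hr2 : r + ε / 2 < 1 / 2 := by linarith
  have hcard := card_filter_near_le hε hr hr2 (fun i => (w i).1) hsep x₀
  have hpi := Real.pi_pos
  have hn' : (0 : ℝ) < n := by exact_mod_cast hn
  calc mollDensity r w x₀
      ≤ (n : ℝ)⁻¹ * (((Finset.univ.filter fun i => Torus.euclidDist (w i).1 x₀ < r).card : ℝ) *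
          (3 / (Real.pi * r ^ 3))) := mollDensity_le_card_mul hr w x₀
    _ ≤ (n : ℝ)⁻¹ * (((r + ε / 2) / (ε / 2)) ^ 3 * (3 / (Real.pi * r ^ 3))) := by
        gcongr
    _ ≤ (n : ℝ)⁻¹ * ((3 * r / ε) ^ 3 * (3 / (Real.pi * r ^ 3))) := by
        have hratio : (r + ε / 2) / (ε / 2) ≤ 3 * r / ε := by
          rw [div_le_div_iff₀ (by positivity) hε]
          nlinarith
        have h3 : ((r + ε / 2) / (ε / 2)) ^ 3 ≤ (3 * r / ε) ^ 3 :=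
          pow_le_pow_left₀ (by positivity) hratio 3
        have hc0 : 0 ≤ 3 / (Real.pi * r ^ 3) := div_nonneg (by norm_num) (by positivity)
        exact mul_le_mul_of_nonneg_left (mul_le_mul_of_nonneg_right h3 hc0) (inv_nonneg.2 (Nat.cast_nonneg n))
    _ = 81 / (Real.pi * n * ε ^ 3) := by
        have hrne : r ≠ 0 := hr.ne'
        have hεne : ε ≠ 0 := hε.ne'
        have hnne : (n : ℝ) ≠ 0 := hn'.ne'
        have hpine : Real.pi ≠ 0 := hpi.ne'
        field_simp
        ring

/-- **Packing bound on the hard-sphere domain at fixed reduced density.** For a configuration of `N + 1` spheres of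
diameter `ε_N = hsDiameter σ N` in the hard-sphere domain of `𝕋³` and a mollification radius `ε_N ≤ r ≤ 1/4`, the
`r`-mollified empirical density is SURELY at most `81/(π σ³)` everywhere (`(N+1) ε_N³ = σ³`). -/
theorem mollDensity_le_packing_hs {σ r : ℝ} (hσ : 0 < σ) {N : ℕ} (hεr : hsDiameter σ N ≤ r) (hr4 : r ≤ 1 / 4)
    {z : Config (N + 1) (Fin 3) T3}
    (hz : z ∈ hardSphereDomain (Torus.geometry (Fin 3)) (N + 1) (hsDiameter σ N)) (x₀ : T3) :
    mollDensity r z x₀ ≤ 81 / (Real.pi * σ ^ 3) := by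
  have hε : 0 < hsDiameter σ N := hsDiameter_pos hσ N
  have hsep : ∀ i j, i ≠ j → hsDiameter σ N ≤ Torus.euclidDist (z i).1 (z j).1 := fun i j hij => hz i j hij
  have h := mollDensity_le_packing hε hεr hr4 z hsep x₀
  have hcube : (((N + 1 : ℕ) : ℝ)) * hsDiameter σ N ^ 3 = σ ^ 3 := by
    rw [hsDiameter_pow_three]
    have : ((N + 1 : ℕ) : ℝ) ≠ 0 := by positivity
    field_simp
  calc mollDensity r z x₀ ≤ 81 / (Real.pi * ((N + 1 : ℕ) : ℝ) * hsDiameter σ N ^ 3) := h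
    _ = 81 / (Real.pi * σ ^ 3) := by rw [mul_assoc, hcube]

/-! ## §2 Equal mass and the first-moment overshoot -/

/-- The centre-integral of the mollified density is the kernel mass: EXACTLY `1` for `0 < r ≤ 1/2`, `n ≥ 1`. -/
theorem integral_mollDensity_eq_one {r : ℝ} (hr : 0 < r) (hr2 : r ≤ 1 / 2) {n : ℕ} (hn : n ≠ 0)
    (w : Config n (Fin 3) T3) : ∫ x₀, mollDensity r w x₀ = 1 := by
  have hci : ∀ i : Fin n, Integrable (fun x₀ : T3 => cone r (w i).1 x₀) volume := by
    intro i
    have hmeas : Measurable fun x₀ : T3 => cone r (w i).1 x₀ := by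
      have : (fun x₀ : T3 => cone r (w i).1 x₀) =
          (fun v : T3 => 3 / (Real.pi * r ^ 3) * max (1 - ‖Torus.reprSym v‖ / r) 0) ∘ fun x₀ => (w i).1 - x₀ := by
        funext x₀
        rfl
      rw [this]
      exact (measurable_coneProfile r).comp (measurable_const.sub measurable_id)
    refine Integrable.of_bound hmeas.aestronglyMeasurable (3 / (Real.pi * r ^ 3)) (ae_of_all _ fun x₀ => ?_)
    rw [Real.norm_eq_abs, abs_of_nonneg (cone_nonneg hr _ _)]
    exact cone_le hr _ _
  simp_rw [mollDensity_eq]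
  rw [integral_const_mul, integral_finsetSum _ fun i _ => hci i]
  simp_rw [integral_cone, coneMass_eq_one hr hr2]
  rw [Finset.sum_const, Finset.card_univ, Fintype.card_fin, nsmul_eq_mul, mul_one,
    inv_mul_cancel₀ (by exact_mod_cast hn)]

/-- The mollified density is integrable in the centre. -/
theorem integrable_mollDensity {r : ℝ} (hr : 0 < r) {n : ℕ} (w : Config n (Fin 3) T3) :
    Integrable (fun x₀ : T3 => mollDensity r w x₀) volume := by
  have hci : ∀ i : Fin n, Integrable (fun x₀ : T3 => cone r (w i).1 x₀) volume := by
    intro i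
    have hmeas : Measurable fun x₀ : T3 => cone r (w i).1 x₀ := by
      have : (fun x₀ : T3 => cone r (w i).1 x₀) =
          (fun v : T3 => 3 / (Real.pi * r ^ 3) * max (1 - ‖Torus.reprSym v‖ / r) 0) ∘ fun x₀ => (w i).1 - x₀ := by
        funext x₀
        rfl
      rw [this]
      exact (measurable_coneProfile r).comp (measurable_const.sub measurable_id)
    refine Integrable.of_bound hmeas.aestronglyMeasurable (3 / (Real.pi * r ^ 3)) (ae_of_all _ fun x₀ => ?_)
    rw [Real.norm_eq_abs, abs_of_nonneg (cone_nonneg hr _ _)]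
    exact cone_le hr _ _
  have : (fun x₀ : T3 => mollDensity r w x₀) = fun x₀ => (n : ℝ)⁻¹ * ∑ i, cone r (w i).1 x₀ :=
    funext fun x₀ => mollDensity_eq r w x₀
  rw [this]
  exact (integrable_finsetSum _ fun i _ => hci i).const_mul _

/-- **First-moment overshoot.** On the Haar probability space `𝕋³`: if `f ≤ M` everywhere, `g ≥ M + κ` on a
measurable set `B`, `∫ g ≤ ∫ f`, and `0 ≤ η < κ · vol B`, then `g x + η < f x` for some `x`. (If not, integrating
`g − f ≥ κ 𝟙_B − η` gives `0 ≥ ∫(g − f) ≥ κ vol B − η > 0`.) -/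
theorem exists_overshoot_of_dense {f g : T3 → ℝ} (hf : Integrable f volume) (hg : Integrable g volume)
    {M κ η : ℝ} {B : Set T3} (hBm : MeasurableSet B) (hfM : ∀ x, f x ≤ M) (hgB : ∀ x ∈ B, M + κ ≤ g x)
    (hint : ∫ x, g x ≤ ∫ x, f x) (hη0 : 0 ≤ η) (hη : η < κ * (volume B).toReal) : ∃ x, g x + η < f x := by
  by_contra hcon
  push Not at hcon
  have hpt : ∀ x, κ * B.indicator (fun _ => (1 : ℝ)) x - η ≤ g x - f x := by
    intro x
    by_cases hx : x ∈ B
    · rw [Set.indicator_of_mem hx, mul_one]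
      linarith [hgB x hx, hfM x]
    · rw [Set.indicator_of_notMem hx, mul_zero]
      linarith [hcon x]
  have hi1 : Integrable (fun x => κ * B.indicator (fun _ => (1 : ℝ)) x - η) volume :=
    (((integrable_const (1 : ℝ)).indicator hBm).const_mul κ).sub (integrable_const η)
  have hle : ∫ x, (κ * B.indicator (fun _ => (1 : ℝ)) x - η) ≤ ∫ x, (g x - f x) :=
    integral_mono hi1 (hg.sub hf) hpt
  rw [integral_sub (((integrable_const (1 : ℝ)).indicator hBm).const_mul κ) (integrable_const η),
    integral_const_mul, integral_indicator_const _ hBm, integral_const, integral_sub hg hf] at hle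
  simp only [smul_eq_mul, mul_one, measureReal_def, measure_univ, ENNReal.toReal_one, one_mul] at hle
  linarith

end Summit.AtomisticToContinuum.HydrodynamicLimit.Theorems.DensityCapNegative

end
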